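import Mathlib
import Summits.SmoothPoincare4.SmoothPoincare4.Theses.CylinderEntropy
import Literature.Geometry.Riemannian.SphericalCylinderEntropy
import Literature.Geometry.Manifold.CylinderSlice

/-!
# Sketch — crux idea `ball-mass-slack` for E = `CylinderEntropy.ThinCrossSectionExists`
(crux-ideate round 2, ideator 4; planner-cruxidea-stmt-SmoothPoincare4-7633-4-0)

LEVER.  The slice is calibrated in the strong sense that a chordal ball of radius `r` centred ANYWHERE on
`N = S⁴×ℝ` cuts at most `V(r) := μH⁴(slice₀ ∩ B̄(e₀, r))` of 4-volume out of it, and the typed kernel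
`K_{p,τ}` is dominated by its radial non-increasing majorant `K*_{τ}(|· - p|)` (by definition of a majorant — no
heat-kernel monotonicity is needed).  Layer-cake then converts BALL-MASS SLACK into ENTROPY SLACK at every scale:
`μH⁴(S ∩ B̄(p,r)) ≤ Λ·V(r)` for all `p ∈ N`, `r > 0` implies `λ_cyl(S) ≤ Λ·C₁`, where
`C₁ := sup_τ |S⁴|⁻¹ ∫_{slice} K*_τ(|x - e₀|) dμ(x)` is an absolute constant (`= 1` in both limits `τ → 0, ∞`;
numerically `C₁ = 1.049` at `τ ≈ 0.15`; fine profile = kit j009266), so `Λ < Λ₀ := (4/e)/C₁ = 1.403` gives `λ_cyl(S) < 4/e` (`MassThin`, FIRST LEMMA,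
provable now: `lintegral` layer cake + `Measure.restrict_apply` on balls + the calibration + a certified 1-D bound).
An `L`-bi-Lipschitz image of the slice has ball-mass slack `L⁸` (area formula `μH⁴(Ψ A) ≤ L⁴ μH⁴ A` and
`Ψ⁻¹ B̄(Ψq, r) ⊆ B̄(q, Lr)`), whence `BiLipThin` for `L < L₀ = 1.046` (`sup_τ C(1.04) = 1.402 < 4/e < 1.505 = sup_τ C(1.05)`).
LINE.  `MassThin Λ₀ → MassSlack Λ₀ → ThinCrossSectionExists` (composition PROVED below), or the Lipschitz-category
variant `MassThin L₀⁸ → BiLipSubspherical L₀ → BiLipSeparates L₀ → LipSlack L₀ → ThinCrossSectionExists` (PROVED).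
The supplies `MassSlack` / `LipSlack` are SPC4-strength but not costume: neither restates E, the summit or a refuted
statement, and neither implies SPC4 by a known argument avoiding entropy (ball-mass pinching `≤ 1.4` or a
`1.04`-bi-Lipschitz homeomorphism `S⁴ → Σ` yield no diffeomorphism classically: Shikata–Karcher need `L < 1+ε(4) ≪ 1.04`;
Allard-type regularity needs density `≤ 1+ε` AND stationarity).
R-SIDE COROLLARIES (PROVED from the stubs + `CylinderRungTwo`): `massRigid` (a homotopy 4-sphere realised in `N`
with `Λ₀`-subspherical ball mass is standard) and `effectiveShikata` (… as an `L₀`-bi-Lipschitz image of the slice).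
-/

noncomputable section

set_option linter.dupNamespace false
set_option linter.unusedVariables false

open scoped BigOperators Topology Manifold MeasureTheory ENNReal NNReal ContDiff ContinuousMap
open Set Function MeasureTheory
open Literature.Geometry.Riemannian.SphericalCylinderEntropy (cylEntropy)
open Literature.Geometry.Manifold.CylinderSlice (sliceMap range_sliceMap sum_sq_sliceMap isSmoothEmbedding_sliceMap)

namespace Summit.SmoothPoincare4.SmoothPoincare4.Cruxes.ThinCrossSectionExists.BallMassSlack

open Summit.SmoothPoincare4.SmoothPoincare4.Theses.CylinderEntropy (ThinCrossSectionExists CylinderRungTwo)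

local notation "E⁶" => EuclideanSpace ℝ (Fin 6)
local notation "E⁴" => EuclideanSpace ℝ (Fin 4)
local notation "𝕊⁴" => (Metric.sphere (0 : EuclideanSpace ℝ (Fin 5)) 1)

/-! ## The crux through named pieces (verbatim sub-expressions of the item) -/

/-- `z ∈ N = S⁴×ℝ ⊂ ℝ⁶`, literally as in the items. -/
def InN (z : E⁶) : Prop := ∑ i : Fin 5, z (Fin.castSucc i) ^ 2 = 1

/-- `N` as a set. -/
def cylN : Set E⁶ := {z | InN z}

/-- "separates the two ends of `N`", literally as in the items. -/
def Separates (A : Set E⁶) : Prop :=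
  ∃ R : ℝ, ∀ a b : E⁶, InN a → InN b → a 5 ≤ -R → R ≤ b 5 → ¬ JoinedIn (cylN \ A) a b

/-- The unit slice `S⁴ × {0}`. -/
def slice₀ : Set E⁶ := {z : E⁶ | ∑ i : Fin 5, z (Fin.castSucc i) ^ 2 = 1 ∧ z 5 = 0}

/-- The bubble-sheet threshold `4/e` as typed. -/
def level : ℝ≥0∞ := ENNReal.ofReal (4 / Real.exp 1)

/-- E's four conjuncts for a given `M` at threshold `c`. -/
def CrossSectionBelow (c : ℝ≥0∞) (M : Type) [TopologicalSpace M] [ChartedSpace E⁴ M] : Prop :=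
  ∃ ι : M → E⁶, Manifold.IsSmoothEmbedding (𝓡 4) (𝓡 6) ∞ ι ∧ (∀ x, InN (ι x)) ∧
    Separates (Set.range ι) ∧ cylEntropy (Set.range ι) < c

/-- The crux is literally `∀` homotopy 4-spheres, `CrossSectionBelow level` (definitional unfolding only). -/
theorem crux_iff :
    ThinCrossSectionExists ↔
      ∀ (M : Type) [TopologicalSpace M] [T2Space M] [SecondCountableTopology M]
        [ChartedSpace E⁴ M] [IsManifold (𝓡 4) ∞ M], M ≃ₕ 𝕊⁴ → CrossSectionBelow level M :=
  Iff.rfl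

/-! ## The lever: ball-mass slack -/

/-- Reference point `e₀ = (1,0,0,0,0,0)` on the slice. -/
def e₀ : E⁶ := EuclideanSpace.single (0 : Fin 6) (1 : ℝ)

/-- `V(r)`: the 4-volume a closed chordal ball of radius `r` centred on the slice cuts out of the slice
(a geodesic ball of `S⁴`; `= μH⁴(S⁴)` once `r ≥ 2`).  By homogeneity it does not depend on the centre. -/
def sliceBallMass (r : ℝ) : ℝ≥0∞ := μH[4] (slice₀ ∩ Metric.closedBall e₀ r)

/-- **`Λ`-subspherical ball mass**: in every closed chordal ball centred at any point of `N`, the set `S` carries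
at most `Λ` times the 4-volume the slice carries in a ball of that radius centred on itself.  (The slice has
`Λ = 1`; the linking spheres of handles force `Λ ≥ 2.6 / 2 / 1.73` for neck- / bubble-sheet- / `S¹×ℝ³`-shaped
features at ANY scale, and `Λ ≥ 16/3` for a closed bubble.) -/
def SubsphericalMass (Λ : ℝ≥0∞) (S : Set E⁶) : Prop :=
  ∀ p : E⁶, InN p → ∀ r : ℝ, 0 < r → μH[4] (S ∩ Metric.closedBall p r) ≤ Λ * sliceBallMass r

/-- Intrinsic (product-metric) closed ball of `N` around `p ∈ N`, radius `r`: `d_{S⁴}(y′,p′)² + (y₅ − p₅)² ≤ r²`, with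
`d_{S⁴} = arccos ⟨y′, p′⟩`. -/
def intrBall (p : E⁶) (r : ℝ) : Set E⁶ :=
  {y | InN y ∧ Real.arccos (∑ i : Fin 5, y (Fin.castSucc i) * p (Fin.castSucc i)) ^ 2 + (y 5 - p 5) ^ 2 ≤ r ^ 2}

/-- `V_N(r)`: 4-volume of the geodesic ball of radius `r` in the slice (`= μH⁴(S⁴)` once `r ≥ π`). -/
def sliceIntrBallMass (r : ℝ) : ℝ≥0∞ := μH[4] (slice₀ ∩ intrBall e₀ r)

/-- **`Λ`-subspherical ball mass, intrinsic form** (product-metric balls).  Numerically the radial majorant of the kernel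
in the PRODUCT distance loses nothing (`C₁^{intr} = 1.0001`, kit j009266: the typed kernel is, to 10⁻⁴, a non-increasing
function of `d_N`), so the intrinsic form of the first lemma holds with `Λ₀^{intr} = 4/e` itself (any `Λ < 4/e`). -/
def SubsphericalMassIntr (Λ : ℝ≥0∞) (S : Set E⁶) : Prop :=
  ∀ p : E⁶, InN p → ∀ r : ℝ, 0 < r → μH[4] (S ∩ intrBall p r) ≤ Λ * sliceIntrBallMass r

/-- **FIRST LEMMA, intrinsic form (`MassThinIntr Λ`)**: for every `Λ < 4/e` (e.g. `Λ = ofReal 1.47`), an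
`S ⊆ N` with `Λ`-subspherical INTRINSIC ball mass has `λ_cyl(S) < 4/e` — constant 1 instead of 1.049.  PROOF ROUTE (size M
given two inputs the route already owns): layer cake; Hamilton's matrix Harnack `∇² log u + g/2t ≥ 0` for the heat kernel of `S⁴`
(named fact Hamilton1993Harnack, doi:10.4310/cag.1993.v1.n1.a6) gives `(log 𝔥)'(θ) ≥ -θ/2τ`, i.e. `𝔥(τ, cos θ) e^{θ²/4τ}`
non-decreasing, so on every product sphere `θ² + Δs² = r²` the kernel is maximal at `Δs = 0` and the radial majorant in `d_N`
equals `𝔥(τ, cos r)`; the calibration `∫_{S⁴} 𝔥 = |S⁴|` (item SliceCalibration) then gives `λ_cyl(S) ≤ m_N(S)` exactly. -/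
def MassThinIntr (Λ : ℝ≥0∞) : Prop :=
  ∀ S : Set E⁶, S ⊆ cylN → SubsphericalMassIntr Λ S → cylEntropy S < level

/-- **FIRST LEMMA (`MassThin Λ`)**: ball-mass slack `Λ` gives entropy slack — every `S ⊆ N` with
`Λ`-subspherical ball mass has typed cylinder entropy `< 4/e`.  Proof route (provable now, size M–L):
`cylDensity S p τ = |S⁴|⁻¹ ∫⁻_S K_{p,τ} ≤ |S⁴|⁻¹ ∫₀^∞ μH⁴(S ∩ B̄(p, R_τ(t))) dt` (layer cake + `{K_{p,τ} > t} ⊆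
B̄(p, R_τ(t))` for the radial majorant) `≤ Λ |S⁴|⁻¹ ∫₀^∞ V(R_τ(t)) dt = Λ |S⁴|⁻¹ ∫_{slice} K*_τ(|x − e₀|) ≤ Λ·C₁`,
with `C₁ = sup_τ(…)` an explicit absolute constant (`→ 1` as `τ → 0` and `τ → ∞`; profile = kit j009266), so the
lemma holds for every `Λ < Λ₀ := (4/e)/C₁ = 1.403` (`C₁ = 1.049`; the Lean proof would fix e.g. `Λ = 7/5`). -/
def MassThin (Λ : ℝ≥0∞) : Prop :=
  ∀ S : Set E⁶, S ⊆ cylN → SubsphericalMass Λ S → cylEntropy S < level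

/-- **SUPPLY (`MassSlack Λ`)** — SPC4-strength, in geometric-measure language: every homotopy 4-sphere has a smooth
end-separating cross-section embedding into `N` whose image has `Λ`-subspherical ball mass.  True at `M ≅ S⁴`
(the slice, `Λ = 1`); for exotic `M` false given the recognition crux; NOT known to imply `M ≅ S⁴` without entropy. -/
def MassSlack (Λ : ℝ≥0∞) : Prop :=
  ∀ (M : Type) [TopologicalSpace M] [T2Space M] [SecondCountableTopology M]
    [ChartedSpace E⁴ M] [IsManifold (𝓡 4) ∞ M], M ≃ₕ 𝕊⁴ →
    ∃ ι : M → E⁶, Manifold.IsSmoothEmbedding (𝓡 4) (𝓡 6) ∞ ι ∧ (∀ x, InN (ι x)) ∧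
      Separates (Set.range ι) ∧ SubsphericalMass Λ (Set.range ι)

/-- **The line concludes the crux BY NAME**: `MassThin Λ → MassSlack Λ → ThinCrossSectionExists`. -/
theorem crux_of_massSlack {Λ : ℝ≥0∞} (hT : MassThin Λ) (hS : MassSlack Λ) : ThinCrossSectionExists := by
  rw [crux_iff]
  intro M _ _ _ _ _ e
  obtain ⟨ι, hι, hN, hsep, hmass⟩ := hS M e
  refine ⟨ι, hι, hN, hsep, hT _ ?_ hmass⟩
  rintro z ⟨x, rfl⟩
  exact hN x

/-! ## The Lipschitz-category variant -/

/-- An `L`-bi-Lipschitz self-map of `ℝ⁶` (chordal metric) mapping `N` into `N` carries the slice to a set with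
`L⁸`-subspherical ball mass: `μH⁴(Ψ A) ≤ L⁴ μH⁴(A)` (Mathlib `LipschitzWith.hausdorffMeasure_image_le`),
`Ψ⁻¹(B̄(Ψ q, r)) ⊆ B̄(q, L r)` (`AntilipschitzWith`), and `V(L r) ≤ L⁴ V(r)` (Bishop–Gromov on `S⁴`, or the explicit
formula `V(r) = 2π² ∫₀^{θ(r)} sin³`).  Size M. -/
def BiLipSubspherical (L : ℝ≥0) : Prop :=
  ∀ Ψ : E⁶ → E⁶, LipschitzWith L Ψ → AntilipschitzWith L Ψ → (∀ z, InN z → InN (Ψ z)) →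
    SubsphericalMass (ENNReal.ofReal ((L : ℝ) ^ 8)) (Ψ '' slice₀)

/-- Such a `Ψ` restricts to a proper self-homeomorphism of `N` (invariance of domain), so the image of the slice
still separates the two ends.  Size S–M (invariance of domain is the only non-Mathlib input). -/
def BiLipSeparates (L : ℝ≥0) : Prop :=
  ∀ Ψ : E⁶ → E⁶, LipschitzWith L Ψ → AntilipschitzWith L Ψ → (∀ z, InN z → InN (Ψ z)) →
    Separates (Ψ '' slice₀)

/-- **SUPPLY, Lipschitz form (`LipSlack L`)**: every homotopy 4-sphere is diffeomorphic to a smooth cross-section of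
`N` that is the image of the slice under an `L`-bi-Lipschitz self-map of `ℝ⁶` preserving `N`.  For `L < L₀ = 1.046`
this implies standardness only through entropy + `CylinderRungTwo`: classically an `L₀`-bi-Lipschitz homeomorphism
`S⁴ → M` gives nothing (Shikata 1966, Karcher 1977: `L < 1 + ε(4) ≪ L₀`). -/
def LipSlack (L : ℝ≥0) : Prop :=
  ∀ (M : Type) [TopologicalSpace M] [T2Space M] [SecondCountableTopology M]
    [ChartedSpace E⁴ M] [IsManifold (𝓡 4) ∞ M], M ≃ₕ 𝕊⁴ →
    ∃ (Ψ : E⁶ → E⁶) (ι : M → E⁶), LipschitzWith L Ψ ∧ AntilipschitzWith L Ψ ∧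
      (∀ z, InN z → InN (Ψ z)) ∧ Manifold.IsSmoothEmbedding (𝓡 4) (𝓡 6) ∞ ι ∧ Set.range ι = Ψ '' slice₀

lemma slice₀_subset_N : ∀ z ∈ slice₀, InN z := fun z hz => hz.1

/-- The Lipschitz line: `MassThin (L⁸) → BiLipSubspherical L → BiLipSeparates L → LipSlack L → E`. -/
theorem crux_of_lipSlack {L : ℝ≥0} (hT : MassThin (ENNReal.ofReal ((L : ℝ) ^ 8)))
    (hB : BiLipSubspherical L) (hS : BiLipSeparates L) (hSl : LipSlack L) : ThinCrossSectionExists := by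
  rw [crux_iff]
  intro M _ _ _ _ _ e
  obtain ⟨Ψ, ι, hlip, hanti, hN, hι, hrange⟩ := hSl M e
  have himN : Ψ '' slice₀ ⊆ cylN := by
    rintro _ ⟨z, hz, rfl⟩
    exact hN z (slice₀_subset_N z hz)
  refine ⟨ι, hι, ?_, ?_, ?_⟩
  · intro x
    exact himN (hrange ▸ Set.mem_range_self x)
  · rw [hrange]; exact hS Ψ hlip hanti hN
  · rw [hrange]; exact hT _ himN (hB Ψ hlip hanti hN)

/-! ## R-side corollaries: mass-pinching rigidity and effective Shikata for `S⁴` inside `N` -/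

/-- Given the recognition crux and `MassThin Λ`: a homotopy 4-sphere realised in `N` by a smooth end-separating
embedding whose image has `Λ`-subspherical ball mass is diffeomorphic to `S⁴`.  With `Λ` just below `Λ₀ = 1.403` this is a
recognition theorem 40% above the slice in ball-mass terms, for which no classical (stationarity-free) argument
is known. -/
theorem massRigid {Λ : ℝ≥0∞} (hR : CylinderRungTwo) (hT : MassThin Λ)
    (M : Type) [TopologicalSpace M] [T2Space M] [SecondCountableTopology M]
    [ChartedSpace E⁴ M] [IsManifold (𝓡 4) ∞ M] (e : M ≃ₕ 𝕊⁴)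
    (ι : M → E⁶) (hι : Manifold.IsSmoothEmbedding (𝓡 4) (𝓡 6) ∞ ι) (hN : ∀ x, InN (ι x))
    (hsep : Separates (Set.range ι)) (hmass : SubsphericalMass Λ (Set.range ι)) :
    Nonempty (M ≃ₘ⟮𝓡 4, 𝓡 4⟯ 𝕊⁴) := by
  have hthin : cylEntropy (Set.range ι) < level := hT _ (by rintro _ ⟨x, rfl⟩; exact hN x) hmass
  obtain ⟨R, hR'⟩ := hsep
  exact hR M e ι hι hN ⟨R, hR'⟩ hthin

/-- Given the recognition crux and the Lipschitz-line lemmas at level `L`: a homotopy 4-sphere realised in `N` as an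
`L`-bi-Lipschitz image of the slice is diffeomorphic to `S⁴` — an effective Shikata gap (`L₀ = 1.046`) for smooth
structures on `S⁴` inside the cylinder. -/
theorem effectiveShikata {L : ℝ≥0} (hR : CylinderRungTwo) (hT : MassThin (ENNReal.ofReal ((L : ℝ) ^ 8)))
    (hB : BiLipSubspherical L) (hS : BiLipSeparates L)
    (M : Type) [TopologicalSpace M] [T2Space M] [SecondCountableTopology M]
    [ChartedSpace E⁴ M] [IsManifold (𝓡 4) ∞ M] (e : M ≃ₕ 𝕊⁴)
    (Ψ : E⁶ → E⁶) (ι : M → E⁶) (hlip : LipschitzWith L Ψ) (hanti : AntilipschitzWith L Ψ)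
    (hN : ∀ z, InN z → InN (Ψ z)) (hι : Manifold.IsSmoothEmbedding (𝓡 4) (𝓡 6) ∞ ι)
    (hrange : Set.range ι = Ψ '' slice₀) :
    Nonempty (M ≃ₘ⟮𝓡 4, 𝓡 4⟯ 𝕊⁴) := by
  have himN : Ψ '' slice₀ ⊆ cylN := by
    rintro _ ⟨z, hz, rfl⟩
    exact hN z (slice₀_subset_N z hz)
  have hNι : ∀ x, InN (ι x) := fun x => himN (hrange ▸ Set.mem_range_self x)
  have hsep : Separates (Set.range ι) := hrange ▸ hS Ψ hlip hanti hN
  have hmass : SubsphericalMass (ENNReal.ofReal ((L : ℝ) ^ 8)) (Set.range ι) := hrange ▸ hB Ψ hlip hanti hN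
  exact massRigid hR hT M e ι hι hNι hsep hmass

/-! ## Non-vacuity of the Lipschitz supply at the standard sphere (`Ψ = id`, `ι =` the slice map) -/

theorem lipSlack_sphere (L : ℝ≥0) (hL : 1 ≤ L) :
    ∃ (Ψ : E⁶ → E⁶) (ι : 𝕊⁴ → E⁶), LipschitzWith L Ψ ∧ AntilipschitzWith L Ψ ∧
      (∀ z, InN z → InN (Ψ z)) ∧ Manifold.IsSmoothEmbedding (𝓡 4) (𝓡 6) ∞ ι ∧ Set.range ι = Ψ '' slice₀ := by
  refine ⟨id, sliceMap 0, ?_, ?_, fun z hz => hz, ?_, ?_⟩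
  · exact LipschitzWith.id.weaken hL
  · intro x y
    have h1 : (1 : ℝ≥0∞) ≤ (L : ℝ≥0∞) := by exact_mod_cast hL
    calc edist x y = 1 * edist (id x) (id y) := by simp
      _ ≤ (L : ℝ≥0∞) * edist (id x) (id y) := by gcongr
  · exact isSmoothEmbedding_sliceMap 0
  · rw [Set.image_id, range_sliceMap 0]; rfl

end Summit.SmoothPoincare4.SmoothPoincare4.Cruxes.ThinCrossSectionExists.BallMassSlack

end
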